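import Mathlib.FieldTheory.IsAlgClosed.AlgebraicClosure
import Literature.AnabelianGeometry.AbsoluteAnabelian.GlobalKummerMaps
import Literature.AnabelianGeometry.AbsoluteAnabelian.MLFGaloisModelPairs
import Literature.AnabelianGeometry.AbsoluteAnabelian.TPairsTrivialContext
import Literature.AnabelianGeometry.EtaleTheta.KummerMapExactness
import HarnessLib

/-!
# [AbsTopIII] Cor 5.2 (iii): the carrier interface `GlobCarrier` is inhabited over EVERY vocabulary, and the
# named fact `Cor52iiiKummerInjective` is a CONTINGENT schema (non-vacuity + kernel counter-model; proof-only)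

S. Mochizuki, *Topics in absolute anabelian geometry III* [MochizukiAbsTopIII2015] (locators = pages of the
author's manuscript `paper:url-5493eb38cbb7`): Def 5.1 (v) pp. 116–117 ("`M_{T⊚}(Π)` … determined by `k_NF(Π)`
[if `T⊚ = TF`], `k^×_NF(Π)` [if `T⊚ = TLG`], equipped with the discrete topology", "equipped with a continuous
action by `Π`"), Cor 5.2 (iii) p. 119 (the Kummer map "`M⊚_TLG ↪ lim_{→J} H¹(J, μ_Ẑ(M⊚_TM))`").

abc-iut-L4-t3 typed the underlying-group data of the objects of `T⊚` as the INTERFACE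
`TPairVocabulary.GlobCarrier W` (`GlobalKummerMaps.lean`: a functor `M ↦ |M|` to commutative groups with `|M⊚|`
divisible and the induced `Π`-action continuous), CONSTRUCTED the Kummer map `GlobCarrier.globalKummerMap` over
it (abc-iut-L2-t3's `EtaleTheta.kummerMap`), and recorded the printed "`↪`" as the named fact
`Cor52iiiKummerInjective W hT C` (FACT-LIST F-3956).  abc-iut-w5-d197's kernel census INHABITATION-CENSUS-L4-v5
lists `TPairVocabulary.GlobCarrier` with ZERO producers; `NumberFieldGlobalKummerInjectiveProofs.lean`
(abc-iut-L4-d2) proves the injectivity at the GENUINE global data `G_F ↷ F̄^×` but notes "the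
`TPairVocabulary`/`GlobCarrier` instance `(W_F, C_F)` is NOT built here (it presupposes a genuine §5 context)".

This PROOF-ONLY file (no `def` / `instance` / `structure`; the carrier is built inside the proofs) records:

* `TPairVocabulary.GlobCarrier.exists_const` — over EVERY vocabulary `W` (every context `R`, every `T`) the
  interface is inhabited by the CONSTANT carrier `M ↦ ℚ̄^×` (the units of Mathlib's `AlgebraicClosure ℚ` — print's
  "`k^×_NF(Π) ≅ k̄^×_NF`", divisible BECAUSE `k̄_NF` is algebraically closed: the tree's
  `IsAlgClosed.rootableByUnits`) with IDENTITY transport along every morphism of `T⊚`; hence the induced action of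
  `Π` on `|M⊚|` is trivial (stabiliser `= Π`, open) and — by the kernel theorem `kummerMap_eq_zero_iff` (abc-iut-c312-4's `KummerMapExactness.lean` over
  abc-iut-L2-t3's `kummerMap`)
  (every compatible root system is invariant under a trivial action) — the global Kummer map of every global
  `T`-pair is IDENTICALLY ZERO; `GlobCarrier.nonempty` is the census form.
* `exists_not_cor52iiiKummerInjective` / `not_forall_cor52iiiKummerInjective` — consequently, at ANY vocabulary with
  a global `T`-pair (e.g. the trivial-group context of abc-iut-w5-d058's `TPairVocabulary.exists_context_tpairFacts`)
  the named fact `Cor52iiiKummerInjective` FAILS for this carrier (`ℚ̄^× ≠ 1`), so its universal closure over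
  `(R, W, C)` is FALSE: F-3956 is a CONTINGENT SCHEMA — refuted at the constant carrier, PROVED at the genuine data
  (`kummerMapHom_openSubgroups_injective`, abc-iut-L4-d2) — i.e. a genuine hypothesis on `(W, C)`, to be consumed BY
  NAME at the intended model exactly as its docstring says ("an assumption on `(W, C)`, true for the genuine data").

HONEST LABEL: carrier GENUINE (`ℚ̄^×` with the printed reason for divisibility), transport / action DEGENERATE
(constant functor, trivial action) — the interface `GlobCarrier` by itself does not see `W` at all; the content of
Cor 5.2 (iii) is carried by the named fact, not by the interface.  A consistency witness for OUR typing, nothing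
about [AbsTopIII]; witnessed ≠ endorsed; typed ≠ proved; refuted-as-typed (universal closure) ≠ refuted-in-print;
nothing here bears on, or takes a side on, [IUTchIII] Cor 3.12.
-/

noncomputable section

open CategoryTheory

namespace Literature.AnabelianGeometry.AbsoluteAnabelian

open Literature.AnabelianGeometry.EtaleTheta

variable {R : GlobalAnabelianContext.{0}} {T : TKind}

namespace TPairVocabulary.GlobCarrier

open scoped Classical in
/-- **`GlobCarrier` is inhabited over every vocabulary — the constant carrier `ℚ̄^×`.**  For every `W` there is
carrier data `C` with: `|M| := ℚ̄^×` for every object `M` of `T⊚` (divisible: `ℚ̄` is algebraically closed), every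
morphism of `T⊚` transported to the identity — so (1) the induced action `Π ↷ |M⊚|` of every global `T`-pair is
TRIVIAL, (2) `|M⊚| ≠ 1`, and (3) the global Kummer map `|M⊚| → lim_{→J} H¹(J, Λ(|M⊚|))` is identically zero
(`= κ(1)`): every compatible system of roots is invariant under the trivial action
(`kummerMap_eq_zero_iff`, `KummerMapExactness.lean`).  DEGENERATE transport, genuine carrier; consistency of OUR typing only.
[cite: MochizukiAbsTopIII2015, Def 5.1 (v) pp. 116–117] -/
theorem exists_const (W : TPairVocabulary R T) :
    ∃ C : W.GlobCarrier,
      (∀ (P : GlobalTPair W) (u : P.theater.grp) (m : C.carrier P.M), C.map (P.act u).hom m = m) ∧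
      (∀ P : GlobalTPair W, ∃ m : C.carrier P.M, m ≠ 1) ∧
      ∀ (P : GlobalTPair W) (m : C.carrier P.M), C.globalKummerMap P m = C.globalKummerMap P 1 := by
  let K : Type := AlgebraicClosure ℚ
  let C : W.GlobCarrier :=
    { carrier := fun _ => CommGrpCat.of Kˣ
      map := fun _ => MonoidHom.id _
      map_id := fun _ => rfl
      map_comp := fun _ _ => MonoidHom.ext fun _ => rfl
      rootable := fun _ => IsAlgClosed.rootableByUnits K
      exists_open_stabilizer := fun P m => ⟨⊤, fun _ _ => rfl⟩ }
  have htriv : ∀ (P : GlobalTPair W) (u : P.theater.grp) (m : C.carrier P.M), C.map (P.act u).hom m = m :=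
    fun _ _ _ => rfl
  refine ⟨C, htriv, fun P => ?_, fun P m => ?_⟩
  · -- `2 ∈ ℚ̄^×` is not `1`
    have h2 : (algebraMap ℚ K 2) ≠ 0 := by
      rw [Ne, map_eq_zero_iff _ (algebraMap ℚ K).injective]; norm_num
    refine ⟨Units.mk0 (algebraMap ℚ K 2) h2, fun h => ?_⟩
    have h' : (algebraMap ℚ K 2) = algebraMap ℚ K 1 := by
      rw [map_one]
      exact (congrArg Units.val h).trans Units.val_one
    exact absurd ((algebraMap ℚ K).injective h') (by norm_num)
  · -- the Kummer map is identically zero under the trivial action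
    letI := C.action P
    letI := C.rootable P
    show kummerMap (openSystem_anti P) (C.isExhausted P) m = kummerMap (openSystem_anti P) (C.isExhausted P) 1
    have hzero : ∀ a : C.carrier P.M, kummerMap (openSystem_anti P) (C.isExhausted P) a = 0 := by
      intro a
      refine (kummerMap_eq_zero_iff (openSystem P) (openSystem_anti P) (C.isExhausted P) a).2
        ⟨OrderDual.toDual ⊤, fun γ => ?_, RootSystem.ofRootableBy a, fun n γ => ?_⟩
      · show ((γ : P.theater.grp) • a) = a
        rw [C.action_smul]
        exact htriv P γ a
      · show ((γ : P.theater.grp) • (RootSystem.ofRootableBy a).root n) = (RootSystem.ofRootableBy a).root n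
        rw [C.action_smul]
        exact htriv P γ _
    rw [hzero m, hzero 1]

/-- **Census form: `Nonempty W.GlobCarrier` for every vocabulary `W`.** (INHABITATION-CENSUS-L4 row
`TPairVocabulary.GlobCarrier`; the constant carrier `ℚ̄^×` of `exists_const` — DEGENERATE transport.)
[cite: MochizukiAbsTopIII2015, Def 5.1 (v) pp. 116–117] -/
theorem nonempty (W : TPairVocabulary R T) : Nonempty W.GlobCarrier := by
  obtain ⟨C, -⟩ := exists_const W
  exact ⟨C⟩

end TPairVocabulary.GlobCarrier

/-- **The named fact `Cor52iiiKummerInjective` (F-3956) FAILS at the constant carrier** of any vocabulary that has a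
global `T`-pair: the Kummer map of `exists_const`'s carrier is identically zero on `ℚ̄^× ≠ 1`, so it is not
injective.  (At the GENUINE global data `G_F ↷ F̄^×` the injectivity is PROVED: abc-iut-L4-d2's
`kummerMapHom_openSubgroups_injective`.) [cite: MochizukiAbsTopIII2015, Cor 5.2 (iii) p. 119] -/
theorem exists_not_cor52iiiKummerInjective (W : TPairVocabulary R T) (hT : T ≠ .TLG) (P : GlobalTPair W) :
    ∃ C : W.GlobCarrier, ¬ Cor52iiiKummerInjective W hT C := by
  obtain ⟨C, -, hne, hconst⟩ := TPairVocabulary.GlobCarrier.exists_const W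
  refine ⟨C, fun h => ?_⟩
  obtain ⟨m, hm⟩ := hne P
  exact hm (h P (hconst P m))

/-- **F-3956: the universal closure of `Cor52iiiKummerInjective` over (context, vocabulary, carrier) is FALSE** —
kernel counter-model: the trivial-group context and degenerate vocabulary of abc-iut-w5-d058's
`TPairVocabulary.exists_context_tpairFacts` (a global `T`-pair exists there) with the constant carrier `ℚ̄^×`.
So the row is a CONTINGENT SCHEMA — an assumption on `(W, C)`, refuted here, true at the genuine data
(`kummerMapHom_openSubgroups_injective`) — to be consumed BY NAME at the intended model.  Says nothing about the
published Cor 5.2 (iii). [cite: MochizukiAbsTopIII2015, Cor 5.2 (iii) p. 119] -/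
theorem not_forall_cor52iiiKummerInjective (T : TKind) (hT : T ≠ .TLG) :
    ¬ ∀ (R : GlobalAnabelianContext.{0}) (W : TPairVocabulary R T) (C : W.GlobCarrier),
      Cor52iiiKummerInjective W hT C := by
  intro h
  obtain ⟨R, W, -, -, ⟨P⟩, -⟩ := TPairVocabulary.exists_context_tpairFacts.{0} T
  obtain ⟨C, hC⟩ := exists_not_cor52iiiKummerInjective W hT P
  exact hC (h R W C)

/-- The two sides together: `Cor52iiiKummerInjective` is SATISFIABLE-OR-NOT depending on the carrier — at the
trivial-group context there are a vocabulary `W` and carriers `C₀` with `¬ Cor52iiiKummerInjective W hT C₀`;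
combined with abc-iut-L4-d2's genuine-data injectivity this classifies F-3956 as contingent.  (Only the negative
inhabitant is constructed here.) [cite: MochizukiAbsTopIII2015, Cor 5.2 (iii) p. 119] -/
theorem exists_vocabulary_not_cor52iiiKummerInjective (T : TKind) (hT : T ≠ .TLG) :
    ∃ (R : GlobalAnabelianContext.{0}) (W : TPairVocabulary R T) (C : W.GlobCarrier),
      Nonempty (GlobalTPair W) ∧ ¬ Cor52iiiKummerInjective W hT C := by
  obtain ⟨R, W, -, -, ⟨P⟩, -⟩ := TPairVocabulary.exists_context_tpairFacts.{0} T
  obtain ⟨C, hC⟩ := exists_not_cor52iiiKummerInjective W hT P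
  exact ⟨R, W, C, ⟨P⟩, hC⟩

end Literature.AnabelianGeometry.AbsoluteAnabelian
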